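import Mathlib
import Summits.MatrixMultiplication.MatrixMultiplication.Theorems.GradedDesignFamily.Negative.CuspFormTrace
import Literature.NumberTheory.GaloisRepresentations.SL2WreathResidualImage

/-!
# The `q = 5` subfield cell `GL₂(F₂₅) ⊃ SL₂(F₅)` does not beat cubes
# (crux `LevelGradedCohnUmans.GradedDesignFamily`, stmt-MatrixMultiplication-7610; negative side,
# line `quadratic-extension-level-one-cell`, stub S3 `stub_subfieldCell`)

HONEST FRAMING.  This DECIDES one finite cell of stub S3 (`|k| = 5`, `|K| = 25`) as a theorem —
a VERDICT, not summit progress: in S3's configuration (any injective `φ : SL₂(k) →* GL₂(K)`,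
`|K| = |k|²`, `Y, Z` level-one separated against `φ(SL₂ k)`, S3's clause verbatim)

* `subfieldCell_twentyfive_wall`: `|Y| + |Z| ≤ 105` — the trace-form wall with the cusp form
  `τ ∘ tr`, `τ(1) = 1`, `τ(−1) = −1`, `τ = 0` elsewhere (`a + a⁻¹ ∉ {1, −1}` for `a ∈ F₅ˣ`);
* `subfieldCell_twentyfive_volume_le`: `|SL₂(F₅)|·|Y|·|Z| ≤ 120 · 2756 = 330720`;
* `subfieldCell_twentyfive_le_sumCubes`: `… < 419874 = 1 + 25³ + 23·26³`, the level-one sum of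
  cubes.

Sorry-free; axioms `propext`, `Classical.choice`, `Quot.sound`.
-/

set_option linter.dupNamespace false

open scoped BigOperators
open Matrix

namespace Summit.MatrixMultiplication.MatrixMultiplication.Theorems.GradedDesignFamily.Negative

/-- **`q = 5` wall**: `|Y| + |Z| ≤ 105` in the subfield cell over `|k| = 5`. [folklore] -/
theorem subfieldCell_twentyfive_wall {k K : Type} [Field k] [Fintype k] [DecidableEq k] [Field K]
    [Fintype K] [DecidableEq K] (hk : Fintype.card k = 5)
    (φ : Matrix.SpecialLinearGroup (Fin 2) k →* Matrix.GeneralLinearGroup (Fin 2) K)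
    (hφ : Function.Injective φ) (hK : Fintype.card K = Fintype.card k ^ 2)
    (Y Z : Finset (Matrix.GeneralLinearGroup (Fin 2) K)) (hY : Y.Nonempty) (hZ : Z.Nonempty)
    (hsep : ∀ z₀ ∈ Z, ∃ cf : (Fin 2 → K) → (Fin 2 → K) → ℂ,
      ∀ a : Matrix.SpecialLinearGroup (Fin 2) k, ∀ y ∈ Y, ∀ y' ∈ Y, ∀ z ∈ Z,
        (∑ u : Fin 2 → K, cf u (((φ a * y * y'⁻¹ * z : Matrix.GeneralLinearGroup (Fin 2) K) :
            Matrix (Fin 2) (Fin 2) K).mulVec u)) =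
          if a = 1 ∧ y = y' ∧ z = z₀ then 1 else 0) :
    Y.card + Z.card ≤ 105 := by
  classical
  -- `char k = 5`
  have hchar : ringChar k = 5 := by
    obtain ⟨n, hp, hn⟩ := FiniteField.card k (ringChar k)
    rw [hk] at hn
    have hdvd : ringChar k ∣ 5 ^ 1 := by
      rw [pow_one, hn]
      exact dvd_pow_self _ (PNat.ne_zero n)
    exact (Nat.prime_dvd_prime_iff_eq hp (by norm_num)).1 (hp.dvd_of_dvd_pow hdvd)
  haveI : CharP k 5 := ringChar.eq_iff.1 hchar
  have h3ne : (3 : k) ≠ 0 := by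
    intro h
    have := (CharP.cast_eq_zero_iff k 5 3).1 (by simpa using h)
    norm_num at this
  have h2ne : (2 : k) ≠ 0 := by
    intro h
    have := (CharP.cast_eq_zero_iff k 5 2).1 (by simpa using h)
    norm_num at this
  have hpm : (1 : k) ≠ -1 := by
    intro h
    apply h2ne
    linear_combination h
  -- `a⁴ = 1` on `kˣ`
  have hquart : ∀ a : k, a ≠ 0 → a ^ 4 = 1 := by
    intro a ha
    have := FiniteField.pow_card_sub_one_eq_one a ha
    rwa [hk] at this
  -- the cusp form `τ ∘ tr`
  set τ : k → ℂ := fun t => (if t = 1 then (1 : ℂ) else 0) - (if t = -1 then 1 else 0) with hτ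
  have hsum : ∑ t : k, τ t = 0 := by
    simp [hτ, Finset.sum_sub_distrib]
  -- `a + a⁻¹ ∉ {1, -1}` for `a ≠ 0`
  have hne1 : ∀ a : k, a ≠ 0 → a + a⁻¹ ≠ 1 := by
    intro a ha hx
    have e1 : a * (a + a⁻¹) = a * a + 1 := by rw [mul_add, mul_inv_cancel₀ ha]
    rw [hx, mul_one] at e1
    have h' : a * a - a + 1 = 0 := by linear_combination -e1
    have h3 : a ^ 3 = -1 := by linear_combination (a + 1) * h'
    have h4 := hquart a ha
    have ha1 : a = -1 := by linear_combination (-1 : k) * h4 + a * h3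
    rw [ha1] at h'
    apply h3ne
    linear_combination h'
  have hne2 : ∀ a : k, a ≠ 0 → a + a⁻¹ ≠ -1 := by
    intro a ha hx
    have e1 : a * (a + a⁻¹) = a * a + 1 := by rw [mul_add, mul_inv_cancel₀ ha]
    rw [hx, mul_neg_one] at e1
    have h' : a * a + a + 1 = 0 := by linear_combination -e1
    have h3 : a ^ 3 = 1 := by linear_combination (a - 1) * h'
    have h4 := hquart a ha
    have ha1 : a = 1 := by linear_combination h4 - a * h3
    rw [ha1] at h'
    apply h3ne
    linear_combination h'
  have hcusp : ∀ a : k, a ≠ 0 → τ (a + a⁻¹) = 0 := by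
    intro a ha
    rw [hτ]
    simp only
    rw [if_neg (hne1 a ha), if_neg (hne2 a ha), sub_zero]
  -- a matrix of trace `1`
  have hdet : Matrix.det !![(1 : k), 1; -1, 0] = 1 := by
    rw [Matrix.det_fin_two_of]
    ring
  have h0 : τ (Matrix.trace ((⟨!![(1 : k), 1; -1, 0], hdet⟩ : Matrix.SpecialLinearGroup (Fin 2) k) :
      Matrix (Fin 2) (Fin 2) k)) ≠ 0 := by
    have htr : Matrix.trace ((⟨!![(1 : k), 1; -1, 0], hdet⟩ : Matrix.SpecialLinearGroup (Fin 2) k) :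
        Matrix (Fin 2) (Fin 2) k) = 1 := by
      simp [Matrix.trace_fin_two]
    rw [htr]
    show ((if (1 : k) = 1 then (1 : ℂ) else 0) - (if (1 : k) = -1 then 1 else 0)) ≠ 0
    rw [if_pos rfl, if_neg hpm]
    norm_num
  have wall := subfieldCell_wall_of_traceForm φ hφ hK Y Z hY hZ hsep τ hsum hcusp _ h0
  rw [hK, hk] at wall
  norm_num at wall
  exact wall

/-- **The `q = 5` subfield cell is empty at exponent three**: design volume
`|SL₂(k)|·|Y|·|Z| ≤ 120 · 2756 = 330720`. [folklore] -/
theorem subfieldCell_twentyfive_volume_le {k K : Type} [Field k] [Fintype k] [DecidableEq k]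
    [Field K] [Fintype K] [DecidableEq K] (hk : Fintype.card k = 5)
    (φ : Matrix.SpecialLinearGroup (Fin 2) k →* Matrix.GeneralLinearGroup (Fin 2) K)
    (hφ : Function.Injective φ) (hK : Fintype.card K = Fintype.card k ^ 2)
    (Y Z : Finset (Matrix.GeneralLinearGroup (Fin 2) K)) (hY : Y.Nonempty) (hZ : Z.Nonempty)
    (hsep : ∀ z₀ ∈ Z, ∃ cf : (Fin 2 → K) → (Fin 2 → K) → ℂ,
      ∀ a : Matrix.SpecialLinearGroup (Fin 2) k, ∀ y ∈ Y, ∀ y' ∈ Y, ∀ z ∈ Z,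
        (∑ u : Fin 2 → K, cf u (((φ a * y * y'⁻¹ * z : Matrix.GeneralLinearGroup (Fin 2) K) :
            Matrix (Fin 2) (Fin 2) K).mulVec u)) =
          if a = 1 ∧ y = y' ∧ z = z₀ then 1 else 0) :
    Nat.card (Matrix.SpecialLinearGroup (Fin 2) k) * Y.card * Z.card ≤ 330720 := by
  have hab := subfieldCell_twentyfive_wall hk φ hφ hK Y Z hY hZ hsep
  have hcard : Nat.card (Matrix.SpecialLinearGroup (Fin 2) k) = 120 := by
    rw [Literature.NumberTheory.GaloisRepresentations.SL2Wreath.natCard_specialLinearGroup_fin_two,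
      hk]; norm_num
  rw [hcard]
  have hprod : 4 * (Y.card * Z.card) ≤ (Y.card + Z.card) * (Y.card + Z.card) := by
    nlinarith [Nat.zero_le (Y.card), Nat.zero_le (Z.card), sq_nonneg ((Y.card : ℤ) - Z.card)]
  have h105 : (Y.card + Z.card) * (Y.card + Z.card) ≤ 105 * 105 := Nat.mul_le_mul hab hab
  have : Y.card * Z.card ≤ 2756 := by omega
  calc 120 * Y.card * Z.card = 120 * (Y.card * Z.card) := by ring
    _ ≤ 120 * 2756 := Nat.mul_le_mul_left _ this
    _ ≤ 330720 := by norm_num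

/-- The same, against the level-one sum of cubes `B₃(|K|) = 1 + |K|³ + (|K| − 2)(|K| + 1)³`
(`= 419874` at `|K| = 25`): the `q = 5` subfield cell does not beat cubes.  VERDICT for the
`q = 5` instance of stub S3 (not summit progress). [folklore] -/
theorem subfieldCell_twentyfive_le_sumCubes {k K : Type} [Field k] [Fintype k] [DecidableEq k]
    [Field K] [Fintype K] [DecidableEq K] (hk : Fintype.card k = 5)
    (φ : Matrix.SpecialLinearGroup (Fin 2) k →* Matrix.GeneralLinearGroup (Fin 2) K)
    (hφ : Function.Injective φ) (hK : Fintype.card K = Fintype.card k ^ 2)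
    (Y Z : Finset (Matrix.GeneralLinearGroup (Fin 2) K)) (hY : Y.Nonempty) (hZ : Z.Nonempty)
    (hsep : ∀ z₀ ∈ Z, ∃ cf : (Fin 2 → K) → (Fin 2 → K) → ℂ,
      ∀ a : Matrix.SpecialLinearGroup (Fin 2) k, ∀ y ∈ Y, ∀ y' ∈ Y, ∀ z ∈ Z,
        (∑ u : Fin 2 → K, cf u (((φ a * y * y'⁻¹ * z : Matrix.GeneralLinearGroup (Fin 2) K) :
            Matrix (Fin 2) (Fin 2) K).mulVec u)) =
          if a = 1 ∧ y = y' ∧ z = z₀ then 1 else 0) :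
    Nat.card (Matrix.SpecialLinearGroup (Fin 2) k) * Y.card * Z.card <
      1 + Fintype.card K ^ 3 + (Fintype.card K - 2) * (Fintype.card K + 1) ^ 3 := by
  have h := subfieldCell_twentyfive_volume_le hk φ hφ hK Y Z hY hZ hsep
  have hcard : Nat.card (Matrix.SpecialLinearGroup (Fin 2) k) = 120 := by
    rw [Literature.NumberTheory.GaloisRepresentations.SL2Wreath.natCard_specialLinearGroup_fin_two,
      hk]; norm_num
  rw [hcard] at h ⊢
  rw [hK, hk]
  norm_num
  omega

end Summit.MatrixMultiplication.MatrixMultiplication.Theorems.GradedDesignFamily.Negative
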